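import Summits.Ventures.PercRepro.C026AcyclicDefs

/-!
# Forests are D-free, part 2: the witness of a `KL`-configuration and its image `T` (p6, gen 10)

On an acyclic marked multigraph (`Acyclic`, `C026AcyclicDefs.lean`) mine-3's D-free inequality `DFreeIneq`
holds in the one-sided form `#KL ≤ #A` (`KL = {bot : a ~ b in δ(S)}`, `A = {bot : τ₅₀(S) ∈ ac|b}`)
by the injection `Φ` of proofs/P6-forest-dfree.md §4.  This file holds the data of the second case:

* `KLWitness` — the data of a `KL`-configuration whose carrier `x ∈ M` is not `c`: the closed edges `eK`
  (to `K`) and `eL` (to `L`) at `x`, and the first edge `e₁` of an open path `c → x`;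
* its image `T = (S ∖ {e₁}) ∪ {eK}`: `T` is `bot` (`isBot_T`), `c` carries `e₁` to `K_T` (`carries_T_c_a`),
  `c` carries nothing to `L_T` (`not_carries_T_c_b`), `eK` is a separating open edge at `x`
  (`not_conn_update_T_eK`), `eL` stays closed between `K_T` and `L_T` (`T_eL`, `conn_T_a_x`, `conn_T_b_uL`),
  and `S` is recovered from `T` (`eq_update_T`).

The injection itself and THEOREM F are in `C026AcyclicPhi.lean`.
-/

namespace PercRepro

open Finset

namespace MultiGraph

variable {V E : Type*} (G : MultiGraph V E)

variable {G}

/-! ### The witness of a `KL`-configuration whose carrier is not `c` -/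

variable (G) in
/-- The data of a `KL`-configuration `S` whose carrier `x ∈ M` is not `c`: the closed edges `eK` (to
`uK ∈ K`) and `eL` (to `uL ∈ L`) at `x`, and the first edge `e₁` (to `y₁`) of an open path from `c` to `x`. -/
structure KLWitness [DecidableEq E] (S : Config E) (a b c : V) where
  /-- the carrier -/
  x : V
  /-- the `K`-end of `eK` -/
  uK : V
  /-- the `L`-end of `eL` -/
  uL : V
  /-- the second vertex of the open path `c → x` -/
  y₁ : V
  /-- the closed edge from `x` to `K` -/
  eK : E
  /-- the closed edge from `x` to `L` -/
  eL : E
  /-- the first edge of the open path `c → x` -/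
  e₁ : E
  /-- `x ∈ M` -/
  hcx : G.Conn S c x
  /-- the carrier is not `c` -/
  hxc : x ≠ c
  /-- `eK` is closed -/
  heK : S eK = false
  /-- `eK` joins `x` and `uK` -/
  hjK : G.JoinsV eK x uK
  /-- `uK ∈ K` -/
  huK : G.Conn S a uK
  /-- `eL` is closed -/
  heL : S eL = false
  /-- `eL` joins `x` and `uL` -/
  hjL : G.JoinsV eL x uL
  /-- `uL ∈ L` -/
  huL : G.Conn S b uL
  /-- `e₁` is open -/
  he₁ : S e₁ = true
  /-- `e₁` joins `c` and `y₁` -/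
  hj₁ : G.JoinsV e₁ c y₁
  /-- `y₁ ↔ x` without `e₁` -/
  hy₁ : G.Conn (Function.update S e₁ false) y₁ x

/-- **A witness exists** for every `KL`-configuration in which `c` does not carry to `K` (Claim 1 + the first
edge of the open path `c → x`). -/
theorem Acyclic.nonempty_klWitness [DecidableEq E] (hG : G.Acyclic) {S : Config E} {a b c : V}
    (hbot : G.IsBot S a b c) (hKL : G.Conn (G.kSwap c S) a b) (hc : ¬ G.Carries S c a) :
    Nonempty (G.KLWitness S a b c) := by
  obtain ⟨x, hcx, ⟨eK, uK, heK, hjK, huK⟩, ⟨eL, uL, heL, hjL, huL⟩⟩ := hG.exists_carrier hbot hKL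
  have hxc : x ≠ c := fun h => hc (h ▸ ⟨eK, uK, heK, hjK, huK⟩)
  obtain ⟨e₁, y₁, he₁, hj₁, hy₁⟩ := G.exists_first_edge hcx hxc
  exact ⟨⟨x, uK, uL, y₁, eK, eL, e₁, hcx, hxc, heK, hjK, huK, heL, hjL, huL, he₁, hj₁, hy₁⟩⟩

namespace KLWitness

variable [DecidableEq E] {S : Config E} {a b c : V} (w : G.KLWitness S a b c)

/-- The intermediate configuration `S₁ = S ∖ {e₁}`. -/
def S₁ : Config E := Function.update S w.e₁ false

/-- The image configuration `T = (S ∖ {e₁}) ∪ {eK}`. -/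
def T : Config E := Function.update w.S₁ w.eK true

/-- `S₁ ≤ S`. -/
theorem S₁_le : w.S₁ ≤ S := update_false_le S w.e₁

/-- `S₁ ≤ T`. -/
theorem S₁_le_T : w.S₁ ≤ w.T := le_update_true _ w.eK

/-- `e₁` is closed in `S₁`. -/
theorem S₁_e₁ : w.S₁ w.e₁ = false := by simp [S₁]

/-- `e₁` (open in `S`) is not `eK` (closed in `S`). -/
theorem e₁_ne_eK : w.e₁ ≠ w.eK := fun h => by
  have := w.he₁; rw [h, w.heK] at this; exact absurd this (by decide)

/-- `eK` is closed in `S₁`. -/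
theorem S₁_eK : w.S₁ w.eK = false := by
  rw [S₁, Function.update_of_ne (Ne.symm w.e₁_ne_eK)]; exact w.heK

/-- `eK` is open in `T`. -/
theorem T_eK : w.T w.eK = true := by simp [T]

/-- `e₁` is closed in `T`. -/
theorem T_e₁ : w.T w.e₁ = false := by
  rw [T, Function.update_of_ne w.e₁_ne_eK]; exact w.S₁_e₁

/-- `T` agrees with `S` away from `e₁` and `eK`. -/
theorem T_apply_of_ne {f : E} (h₁ : f ≠ w.e₁) (hK : f ≠ w.eK) : w.T f = S f := by
  rw [T, Function.update_of_ne hK, S₁, Function.update_of_ne h₁]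

/-- Closing `eK` in `T` gives back `S₁`. -/
theorem update_T_eK : Function.update w.T w.eK false = w.S₁ := by
  ext f
  by_cases hf : f = w.eK
  · subst hf; simp [w.S₁_eK]
  · rw [Function.update_of_ne hf, T, Function.update_of_ne hf]

/-- `S` is recovered from `T`, `eK`, `e₁`. -/
theorem eq_update_T : S = Function.update (Function.update w.T w.eK false) w.e₁ true := by
  rw [w.update_T_eK]
  ext f
  by_cases hf : f = w.e₁
  · subst hf; simp [w.he₁]
  · rw [Function.update_of_ne hf, S₁, Function.update_of_ne hf]

/-- In `S₁`, `x` is cut off from `c` (the open path `c → x` had to use `e₁`). -/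
theorem not_conn_S₁_x_c (hG : G.Acyclic) : ¬ G.Conn w.S₁ w.x c := fun h =>
  hG.not_conn_of_closed w.S₁_e₁ w.hj₁ (w.hy₁.trans h).symm

/-- Connectivity in `T`, read through the contraction lemma at `eK`. -/
theorem conn_T_iff (u v : V) :
    G.Conn w.T u v ↔ G.Conn w.S₁ u v ∨ (G.Conn w.S₁ u w.x ∧ G.Conn w.S₁ w.uK v) ∨
      (G.Conn w.S₁ u w.uK ∧ G.Conn w.S₁ w.x v) := by
  rw [T, G.conn_update_true_iff]
  rcases w.hjK with ⟨h1, h2⟩ | ⟨h1, h2⟩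
  · rw [h1, h2]
  · rw [h1, h2]
    constructor
    · rintro (h | ⟨h3, h4⟩ | ⟨h3, h4⟩)
      · exact Or.inl h
      · exact Or.inr (Or.inr ⟨h3, h4⟩)
      · exact Or.inr (Or.inl ⟨h3, h4⟩)
    · rintro (h | ⟨h3, h4⟩ | ⟨h3, h4⟩)
      · exact Or.inl h
      · exact Or.inr (Or.inr ⟨h3, h4⟩)
      · exact Or.inr (Or.inl ⟨h3, h4⟩)

/-- `a ≁ x` in `S₁` (`x ∈ M`, `S` is `bot`). -/
theorem not_conn_S₁_a_x (hbot : G.IsBot S a b c) : ¬ G.Conn w.S₁ a w.x := fun h =>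
  hbot.2.1 ((G.conn_update_false h).trans w.hcx.symm)

/-- `b ≁ x` in `S₁`. -/
theorem not_conn_S₁_b_x (hbot : G.IsBot S a b c) : ¬ G.Conn w.S₁ b w.x := fun h =>
  hbot.2.2 ((G.conn_update_false h).trans w.hcx.symm)

/-- `b ≁ uK` in `S₁` (`uK ∈ K`). -/
theorem not_conn_S₁_b_uK (hbot : G.IsBot S a b c) : ¬ G.Conn w.S₁ b w.uK := fun h =>
  hbot.1 (w.huK.trans (G.conn_update_false h).symm)

/-- `T` is a `bot` configuration. -/
theorem isBot_T (hG : G.Acyclic) (hbot : G.IsBot S a b c) : G.IsBot w.T a b c := by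
  refine ⟨?_, ?_, ?_⟩
  · rintro h
    rcases (w.conn_T_iff a b).1 h with h | ⟨h, -⟩ | ⟨-, h⟩
    · exact hbot.1 (G.conn_update_false h)
    · exact w.not_conn_S₁_a_x hbot h
    · exact w.not_conn_S₁_b_x hbot h.symm
  · rintro h
    rcases (w.conn_T_iff a c).1 h with h | ⟨h, -⟩ | ⟨-, h⟩
    · exact hbot.2.1 (G.conn_update_false h)
    · exact w.not_conn_S₁_a_x hbot h
    · exact w.not_conn_S₁_x_c hG h
  · rintro h
    rcases (w.conn_T_iff b c).1 h with h | ⟨h, -⟩ | ⟨h, -⟩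
    · exact hbot.2.2 (G.conn_update_false h)
    · exact w.not_conn_S₁_b_x hbot h
    · exact w.not_conn_S₁_b_uK hbot h

/-- Open paths inside `K` or `L` survive in `T` (they avoid `e₁`, which is at `c`). -/
theorem conn_T_of_conn_of_not_conn_c {v u : V} (hvc : ¬ G.Conn S v c) (h : G.Conn S v u) :
    G.Conn w.T v u := by
  refine G.conn_of_open_edges (ω := S) (v := v) ?_ h
  intro f hf hfv
  have hf₁ : f ≠ w.e₁ := by
    intro hfe
    apply hvc
    have hj : G.JoinsV f c w.y₁ := by rw [hfe]; exact w.hj₁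
    have hK1 : G.fst f ∈ G.cluster S v := by
      rcases hfv with h | h
      · exact h
      · exact G.fst_mem_cluster_of_open hf h
    have hK2 : G.snd f ∈ G.cluster S v := G.snd_mem_cluster_of_open hf hK1
    rcases hj with ⟨h1, -⟩ | ⟨-, h2⟩
    · rw [h1] at hK1; exact (mem_cluster G).1 hK1
    · rw [h2] at hK2; exact (mem_cluster G).1 hK2
  have hfK : f ≠ w.eK := fun h => by rw [h, w.heK] at hf; exact absurd hf (by decide)
  rw [w.T_apply_of_ne hf₁ hfK]; exact hf

/-- `a ↔ uK` in `T`. -/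
theorem conn_T_a_uK (hbot : G.IsBot S a b c) : G.Conn w.T a w.uK :=
  w.conn_T_of_conn_of_not_conn_c hbot.2.1 w.huK

/-- `b ↔ uL` in `T`. -/
theorem conn_T_b_uL (hbot : G.IsBot S a b c) : G.Conn w.T b w.uL :=
  w.conn_T_of_conn_of_not_conn_c hbot.2.2 w.huL

/-- `a ↔ x` in `T` (through the opened `eK`). -/
theorem conn_T_a_x (hbot : G.IsBot S a b c) : G.Conn w.T a w.x :=
  (w.conn_T_a_uK hbot).trans (Conn.of_openAdj ⟨w.eK, w.T_eK, w.hjK.symm⟩)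

/-- `a ↔ y₁` in `T` (`y₁ ↔ x` away from `e₁`). -/
theorem conn_T_a_y₁ (hbot : G.IsBot S a b c) : G.Conn w.T a w.y₁ :=
  (w.conn_T_a_x hbot).trans (w.hy₁.mono w.S₁_le_T).symm

/-- `eL` is not `eK` (one end in `K`, the other in `L`). -/
theorem eL_ne_eK (hbot : G.IsBot S a b c) : w.eL ≠ w.eK := by
  intro h
  have hjK' : G.JoinsV w.eL w.x w.uK := by rw [h]; exact w.hjK
  rcases JoinsV.eq_or_eq w.hjL hjK' with ⟨-, h2⟩ | ⟨h1, -⟩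
  · have h3 : G.Conn S b w.uK := by rw [← h2]; exact w.huL
    exact hbot.1 (w.huK.trans h3.symm)
  · have h3 : G.Conn S a w.x := by rw [h1]; exact w.huK
    exact hbot.2.1 (h3.trans w.hcx.symm)

/-- `eL` (closed) is not `e₁` (open). -/
theorem eL_ne_e₁ : w.eL ≠ w.e₁ := fun h => by
  have := w.heL; rw [h, w.he₁] at this; exact absurd this (by decide)

/-- `eL` is closed in `T`. -/
theorem T_eL (hbot : G.IsBot S a b c) : w.T w.eL = false := by
  rw [w.T_apply_of_ne w.eL_ne_e₁ (w.eL_ne_eK hbot)]; exact w.heL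

/-- `c` carries `e₁` to `K_T`. -/
theorem carries_T_c_a (hbot : G.IsBot S a b c) : G.Carries w.T c a :=
  ⟨w.e₁, w.y₁, w.T_e₁, w.hj₁, w.conn_T_a_y₁ hbot⟩

/-- **`eK` separates `a` from `x` in `T`**: closing it gives back `S₁`, where `a ≁ x`. -/
theorem not_conn_update_T_eK (hbot : G.IsBot S a b c) :
    ¬ G.Conn (Function.update w.T w.eK false) a w.x := by
  rw [w.update_T_eK]; exact w.not_conn_S₁_a_x hbot

/-- Connectivity from `b` in `T` is connectivity from `b` in `S` (the opened edge `eK` is out of reach). -/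
theorem conn_S_b_of_conn_T (hbot : G.IsBot S a b c) {z : V} (h : G.Conn w.T b z) : G.Conn S b z := by
  rcases (w.conn_T_iff b z).1 h with h | ⟨h, -⟩ | ⟨h, -⟩
  · exact G.conn_update_false h
  · exact absurd h (w.not_conn_S₁_b_x hbot)
  · exact absurd h (w.not_conn_S₁_b_uK hbot)

/-- In `T`, `c` carries no closed edge to `L`. -/
theorem not_carries_T_c_b (hG : G.Acyclic) (hbot : G.IsBot S a b c) : ¬ G.Carries w.T c b := by
  rintro ⟨g, z, hg, hjg, hbz⟩
  have hbz' : G.Conn S b z := w.conn_S_b_of_conn_T hbot hbz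
  have hgK : g ≠ w.eK := fun h => by rw [h, w.T_eK] at hg; exact absurd hg (by decide)
  by_cases hg₁ : g = w.e₁
  · subst hg₁
    rcases JoinsV.eq_or_eq w.hj₁ hjg with ⟨-, h2⟩ | ⟨h1, -⟩
    · exact hbot.2.2 ((h2 ▸ hbz').trans ((G.conn_update_false w.hy₁).trans w.hcx.symm))
    · exact hbot.2.2 (h1 ▸ hbz')
  · have hgS : S g = false := by rw [← w.T_apply_of_ne hg₁ hgK]; exact hg
    by_cases hgL : g = w.eL
    · subst hgL
      rcases JoinsV.eq_or_eq hjg w.hjL with ⟨h1, -⟩ | ⟨h1, -⟩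
      · exact w.hxc h1.symm
      · exact hbot.2.2 (h1 ▸ w.huL)
    · exact hG.not_two_closed' hgS hgL hjg w.hjL w.hcx (hbz'.symm.trans w.huL)

end KLWitness

end MultiGraph

end PercRepro
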